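import Literature.NumberTheory.GaloisRepresentations.SerreProp18GL2Fp
import HarnessLib

/-!
# Serre 1972: the group-theoretic lemmas of §1.11 (Cor.), §4.2 b), §5.2 (iv), §5.4 (Prop. 21 i)

Topic `NumberTheory/GaloisRepresentations`.  J.-P. Serre, *Propriétés galoisiennes des points
d'ordre fini des courbes elliptiques*, Invent. Math. 15 (1972), 259–331.  This file (theorems
only, nothing is defined, no named fact) isolates the pieces of pure group theory in
`GL₂(𝔽_p)` through which the local information of §1 and the global information of §4–§5 are
fed into Prop. 17 of §2.7 (the tree's `Serre1972.prop17`, `prop17_halfSplitCartan`) in the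
proof of the open image theorem (§4.2, Théorème 2 — the tree's named fact
`Literature.NumberTheory.EllipticCurves.serre_open_image`) and of its semistable variant over `ℚ`
(§5.4, Prop. 21):

* §1.11, Corollaire to Prop. 11, (b)–(c) (and the identical Corollaire to Prop. 13, §1.12), group
  content: a subgroup `H ⊆ GL₂(𝔽_p)` acting on a line `𝔽_p v` through a character *onto* `𝔽_pˣ`
  and trivially on the quotient `𝔽_p² / 𝔽_p v` contains a split half-Cartan subgroup
  ("représentable matriciellement sous la forme `(* 0; 0 1)`" / "`(* *; 0 1)`"):
  `exists_conj_eq_halfDiagonalHom`, `halfSplitCartan_le_zpowers_of_conj_eq`,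
  `exists_halfSplitCartan_le`.
* §4.2 b), the case list i)/ii): `prop17_cases` (`G = GL₂`, or `G ⊆` Borel, or `G ⊆` a Cartan
  subgroup, or `G ⊆ N(C)` and `G ⊄ C`); the complement used in §4.2 c) (Lemme 3), "les éléments
  de `N_l - C_l` ont une trace nulle", is already the tree's
  `Serre1972.trace_eq_zero_of_mem_normalizer_of_not_mem` (`SerreProp19GL2Fp`).
* §5.2 (iv): an element `c` with `c² = 1`, `det c = -1` (complex conjugation) is not contained
  in a non-split Cartan subgroup: `ne_smul_one_of_mul_self_eq_one_of_det_eq_neg_one`,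
  `not_mem_unitGroup_of_mul_self_eq_one`, `not_le_unitGroup_of_mem`.
* §5.4, proof of Prop. 21 i), second paragraph: if `G ≠ GL₂(𝔽_p)` contains such a `c` and a split
  half-Cartan subgroup (`p ≠ 2, 5`) or a non-split Cartan subgroup (`p ≠ 2`), then `G` lies in a
  Borel subgroup, or in the normaliser `N` of a Cartan subgroup `C` with `G ⊄ C`:
  `borel_or_normalizer_of_halfSplitCartan_le`, `borel_or_normalizer_of_unitGroup_le`; and the
  first paragraph (`p ∣ |G|`, `det G = 𝔽_pˣ`): `eq_top_or_borel_of_dvd_card`.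

Vocabulary: `splitCartan`, `halfSplitCartan`, `halfDiagonalHom`, `unitGroup`, `cartanSubgroups`
(`SerreCartanSubgroupsGL2Fp`), Borel subgroups = the tree's `eigenvectorStabilizer v hv`
(`ProjectiveType`).

## References

* [Serre1972] J.-P. Serre, Invent. Math. 15 (1972) 259–331: §1.11 (Cor. to Prop. 11), §1.12
  (Cor. to Prop. 13), §2.7 Prop. 17, §4.2 (b), Lemme 3), §5.2 (iv), §5.4 (Prop. 21, proof of i)).
-/

open Matrix
open scoped MatrixGroups

namespace Literature.NumberTheory.GaloisRepresentations.Serre1972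

section Field

variable {F : Type*} [Field F]

/-! ### §5.2 (iv): complex conjugation is not in a non-split Cartan subgroup -/

/-- An element `c ∈ GL₂(F)` with `c² = 1` and `det c = -1` is not scalar when `2 ≠ 0` in `F`
(a scalar `a` with `a² = 1 = -1` forces `2 = 0`). [cite: Serre1972, §5.2 (iv)] -/
theorem ne_smul_one_of_mul_self_eq_one_of_det_eq_neg_one (h2 : (2 : F) ≠ 0) {c : GL (Fin 2) F}
    (hc : c * c = 1) (hdet : Matrix.det (c : Matrix (Fin 2) (Fin 2) F) = -1) (a : F) :
    (c : Matrix (Fin 2) (Fin 2) F) ≠ a • 1 := by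
  intro ha
  have hcc : (c : Matrix (Fin 2) (Fin 2) F) * c = 1 := by rw [← Units.val_mul, hc, Units.val_one]
  have h1 : a * a = 1 := by
    have := congrFun (congrFun hcc 0) 0
    simpa [ha, Matrix.mul_apply, Fin.sum_univ_two] using this
  have h3 : a * a = -1 := by
    rw [ha, Matrix.det_smul, Matrix.det_one, mul_one, Fintype.card_fin] at hdet
    rw [← sq, hdet]
  apply h2
  linear_combination h3 - h1

/-- **§5.2 (iv), group content.** A non-scalar `c ∈ GL₂(F)` with `c² = 1` does not lie in
`kˣ` for any subalgebra `k ⊆ M₂(F)` which is a field (in a field `x² = 1` forces `x = ±1`):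
"`φ_l(G)` contient un élément `c` de valeurs propres `{1, -1}` … Il en résulte que, si `l ≠ 2`,
`φ_l(G)` n'est pas contenu dans un sous-groupe de Cartan non déployé".
[cite: Serre1972, §5.2 (iv)] -/
theorem not_mem_unitGroup_of_mul_self_eq_one {k : Subalgebra F (Matrix (Fin 2) (Fin 2) F)}
    (hk : IsField k) {c : GL (Fin 2) F} (hc : c * c = 1)
    (hcs : ∀ a : F, (c : Matrix (Fin 2) (Fin 2) F) ≠ a • 1) : c ∉ unitGroup k := by
  intro hmem
  rw [mem_unitGroup_iff] at hmem
  have hcc : (c : Matrix (Fin 2) (Fin 2) F) * c = 1 := by rw [← Units.val_mul, hc, Units.val_one]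
  set x : k := ⟨(c : Matrix (Fin 2) (Fin 2) F), hmem⟩ with hx
  have hxx : (x - 1) * (x + 1) = 0 := by
    have : x * x = 1 := Subtype.ext hcc
    calc (x - 1) * (x + 1) = x * x - 1 := by
          rw [sub_mul, one_mul, mul_add, mul_one]; abel
      _ = 0 := by rw [this, sub_self]
  by_cases hx1 : x - 1 = 0
  · apply hcs 1
    have := congrArg Subtype.val (sub_eq_zero.mp hx1)
    rw [one_smul]
    exact this
  · obtain ⟨b, hb⟩ := hk.mul_inv_cancel hx1
    have hx2 : x + 1 = 0 := by
      calc x + 1 = (b * (x - 1)) * (x + 1) := by rw [hk.mul_comm b, hb, one_mul]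
        _ = 0 := by rw [mul_assoc, hxx, mul_zero]
    apply hcs (-1)
    have := congrArg Subtype.val (eq_neg_of_add_eq_zero_left hx2)
    rw [neg_smul, one_smul]
    exact this

/-- **§5.2 (iv).** A subgroup `G ⊆ GL₂(F)` (`2 ≠ 0` in `F`) containing an element `c` with
`c² = 1` and `det c = -1` is not contained in the non-split Cartan subgroup `kˣ`, `k ⊆ M₂(F)` a
field. [cite: Serre1972, §5.2 (iv)] -/
theorem not_le_unitGroup_of_mem (h2 : (2 : F) ≠ 0) {k : Subalgebra F (Matrix (Fin 2) (Fin 2) F)}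
    (hk : IsField k) {G : Subgroup (GL (Fin 2) F)} {c : GL (Fin 2) F} (hcG : c ∈ G)
    (hc : c * c = 1) (hdet : Matrix.det (c : Matrix (Fin 2) (Fin 2) F) = -1) :
    ¬ G ≤ unitGroup k := fun h ↦
  not_mem_unitGroup_of_mul_self_eq_one hk hc
    (ne_smul_one_of_mul_self_eq_one_of_det_eq_neg_one h2 hc hdet) (h hcG)

/-! ### Split Cartan subgroups lie in Borel subgroups -/

/-- The columns of an invertible matrix are non-zero. [folklore] -/
theorem col_ne_zero (P : GL (Fin 2) F) (j : Fin 2) : (P : Matrix (Fin 2) (Fin 2) F).col j ≠ 0 := by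
  intro h
  apply GL2.det_ne_zero P
  have h0 := congrFun h 0
  have h1 := congrFun h 1
  simp only [Matrix.col_apply, Pi.zero_apply] at h0 h1
  rw [Matrix.det_fin_two]
  fin_cases j <;> simp_all

/-- A split Cartan subgroup fixes its first line: `splitCartan P ⊆` the Borel subgroup of
`D₁ = F · P e₀` (n° 2.1 a / 2.3). [cite: Serre1972, §2.1] -/
theorem splitCartan_le_eigenvectorStabilizer (P : GL (Fin 2) F) :
    splitCartan P ≤
      eigenvectorStabilizer ((P : Matrix (Fin 2) (Fin 2) F).col 0) (col_ne_zero P 0) :=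
  fun _ hg ↦ mem_eigenvectorStabilizer_iff.mpr (mem_splitCartan_iff_col.mp hg).1

/-! ### §1.11, Corollaire (b)–(c): from a character on a line to a split half-Cartan subgroup -/

/-- **Diagonalisation of a "half-Borel" element.** Let `g ∈ GL₂(F)` have the eigenvector `v ≠ 0`
with eigenvalue `a ≠ 1` and act trivially on `F² / F v` (`g w - w ∈ F v` for all `w`). Then in a
suitable basis `(w, v)` (the columns of `P`, the second one being `v`) the matrix of `g` is
`diag(1, a)` (§1.11, proof of the Corollaire: an element of `(* *; 0 1)` with `* = a ≠ 1` is
conjugate to `(a 0; 0 1)`). [cite: Serre1972, §1.11, Cor. to Prop. 11 (proof)] -/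
theorem exists_conj_eq_halfDiagonalHom {g : GL (Fin 2) F} {v : Fin 2 → F} (hv : v ≠ 0) {a : Fˣ}
    (ha1 : a ≠ 1) (hgv : (g : Matrix (Fin 2) (Fin 2) F) *ᵥ v = (a : F) • v)
    (hquot : ∀ w : Fin 2 → F, ∃ b : F, (g : Matrix (Fin 2) (Fin 2) F) *ᵥ w - w = b • v) :
    ∃ P : GL (Fin 2) F, (P : Matrix (Fin 2) (Fin 2) F).col 1 = v ∧
      P⁻¹ * g * P = halfDiagonalHom a := by
  obtain ⟨v', hv'⟩ := exists_det_cols_ne_zero hv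
  obtain ⟨b, hb⟩ := hquot v'
  have ha1' : (1 : F) - a ≠ 0 := by
    intro h
    apply ha1
    exact Units.ext ((sub_eq_zero.mp h).symm)
  -- the fixed vector `w = v' + t v`, `t = b / (1 - a)`
  set t : F := b / (1 - a) with ht
  set w : Fin 2 → F := v' + t • v with hw
  have hgw : (g : Matrix (Fin 2) (Fin 2) F) *ᵥ w = w := by
    have h1 : (g : Matrix (Fin 2) (Fin 2) F) *ᵥ v' = v' + b • v := by rw [← hb, add_sub_cancel]
    rw [hw, Matrix.mulVec_add, Matrix.mulVec_smul, hgv, h1, smul_smul, add_assoc, ← add_smul]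
    congr 2
    rw [ht]
    field_simp
    ring
  -- the change-of-basis matrix with columns `w, v`
  set Q : Matrix (Fin 2) (Fin 2) F := !![w 0, v 0; w 1, v 1] with hQ
  have hQdet : Q.det ≠ 0 := by
    rw [hQ, Matrix.det_fin_two_of]
    intro h
    apply hv'
    simp only [hw, Pi.add_apply, Pi.smul_apply, smul_eq_mul] at h
    linear_combination -h
  refine ⟨GeneralLinearGroup.mkOfDetNeZero Q hQdet, ?_, ?_⟩
  · ext i
    fin_cases i <;> rfl
  · -- `g Q = Q diag(1, a)`
    have hgQ : (g : Matrix (Fin 2) (Fin 2) F) * Q = Q * diagonal ![1, (a : F)] := by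
      rw [hQ, mul_cols, hgw, hgv]
      ext i j
      fin_cases i <;> fin_cases j <;> simp [Matrix.mul_apply, Fin.sum_univ_two, mul_comm]
    apply Units.ext
    have hQu : IsUnit Q.det := hQdet.isUnit
    simp only [Units.val_mul, Matrix.coe_units_inv, coe_halfDiagonalHom]
    change Q⁻¹ * (g : Matrix (Fin 2) (Fin 2) F) * Q = diagonal ![1, (a : F)]
    rw [Matrix.mul_assoc, hgQ, ← Matrix.mul_assoc, Matrix.nonsing_inv_mul _ hQu, Matrix.one_mul]

/-- **From one generator to the split half-Cartan subgroup.** If `P⁻¹ g P = diag(1, a)` with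
`a` a generator of `Fˣ`, then the split half-Cartan subgroup `P (1 0; 0 *) P⁻¹` consists of
powers of `g` ("un groupe cyclique d'ordre `p - 1`, représentable matriciellement sous la forme
`(* 0; 0 1)`", §1.11 Cor. (b)). [cite: Serre1972, §1.11, Cor. to Prop. 11 (b)] -/
theorem halfSplitCartan_le_zpowers_of_conj_eq {P g : GL (Fin 2) F} {a : Fˣ}
    (ha : ∀ u : Fˣ, u ∈ Subgroup.zpowers a) (hg : P⁻¹ * g * P = halfDiagonalHom a) :
    halfSplitCartan P ≤ Subgroup.zpowers g := by
  rintro x ⟨d, hd, rfl⟩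
  have hd' : d ∈ (halfDiagonalHom (F := F)).range := by
    rw [range_halfDiagonalHom]
    exact hd
  obtain ⟨u, rfl⟩ := hd'
  obtain ⟨n, rfl⟩ := Subgroup.mem_zpowers_iff.mp (ha u)
  have hg' : g = P * halfDiagonalHom a * P⁻¹ := by rw [← hg]; group
  refine Subgroup.mem_zpowers_iff.mpr ⟨n, ?_⟩
  rw [hg', conj_zpow, ← map_zpow, MulEquiv.coe_toMonoidHom, MulAut.conj_apply]

/-- **§1.11, Corollaire to Prop. 11, (b)–(c) — group content** (identical for the Corollaire to
Prop. 13, §1.12).  Let `H ⊆ GL₂(𝔽_p)` act trivially on `𝔽_p² / 𝔽_p v` (`h w - w ∈ 𝔽_p v`), and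
let the character of `H` on the line `𝔽_p v` be onto `𝔽_pˣ` (for the inertia group: `χ_Y = 1`
and `χ_X = θ_{p-1}` is onto, Prop. 11 and Cor. (a)).  Then `H` contains a split half-Cartan
subgroup, with respect to a basis whose second vector is `v`: in case (b) `H` *is* this cyclic
group of order `p - 1`, "`(* 0; 0 1)`", in case (c) `H = (* *; 0 1)` contains it.
[cite: Serre1972, §1.11, Cor. to Prop. 11 (b)–(c); §1.12, Cor. to Prop. 13] -/
theorem exists_halfSplitCartan_le {p : ℕ} [Fact p.Prime] {H : Subgroup (GL (Fin 2) (ZMod p))}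
    {v : Fin 2 → ZMod p} (hv : v ≠ 0)
    (hquot : ∀ h ∈ H, ∀ w : Fin 2 → ZMod p, ∃ b : ZMod p,
      (h : Matrix (Fin 2) (Fin 2) (ZMod p)) *ᵥ w - w = b • v)
    (hsurj : ∀ a : (ZMod p)ˣ, ∃ h ∈ H,
      (h : Matrix (Fin 2) (Fin 2) (ZMod p)) *ᵥ v = (a : ZMod p) • v) :
    ∃ P : GL (Fin 2) (ZMod p), (P : Matrix (Fin 2) (Fin 2) (ZMod p)).col 1 = v ∧
      halfSplitCartan P ≤ H := by
  obtain ⟨a, ha⟩ := IsCyclic.exists_generator (α := (ZMod p)ˣ)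
  by_cases ha1 : a = 1
  · -- `𝔽_pˣ = {1}` (`p = 2`): the half-Cartan subgroups are trivial
    obtain ⟨v', hv'⟩ := exists_det_cols_ne_zero hv
    have hQdet : (!![v' 0, v 0; v' 1, v 1] : Matrix (Fin 2) (Fin 2) (ZMod p)).det ≠ 0 := by
      rw [Matrix.det_fin_two_of]
      intro h
      apply hv'
      linear_combination -h
    refine ⟨GeneralLinearGroup.mkOfDetNeZero _ hQdet, ?_, ?_⟩
    · ext i
      fin_cases i <;> rfl
    · rintro x ⟨d, hd, rfl⟩
      have hd' : d ∈ (halfDiagonalHom (F := ZMod p)).range := by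
        rw [range_halfDiagonalHom]
        exact hd
      obtain ⟨u, rfl⟩ := hd'
      have hu : u = 1 := by
        obtain ⟨n, rfl⟩ := Subgroup.mem_zpowers_iff.mp (ha u)
        rw [ha1, _root_.one_zpow]
      rw [hu, map_one, map_one]
      exact H.one_mem
  · obtain ⟨h, hh, hhv⟩ := hsurj a
    obtain ⟨P, hPv, hconj⟩ := exists_conj_eq_halfDiagonalHom hv ha1 hhv (hquot h hh)
    exact ⟨P, hPv, (halfSplitCartan_le_zpowers_of_conj_eq ha hconj).trans
      ((Subgroup.zpowers_le (G := GL (Fin 2) (ZMod p))).mpr hh)⟩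

end Field

/-! ### Over `𝔽_p`: §4.2 b) and §5.4 -/

section Prime

variable {p : ℕ} [Fact p.Prime]

/-- **§4.2 b), the list of cases.**  For every subgroup `G` of `GL₂(𝔽_p)` containing a Cartan
subgroup (`p ≠ 5` if it is split) or — `prop17_cases_halfSplitCartan` — a split half-Cartan
subgroup: `G = GL₂(𝔽_p)`, or (i) `G` is contained in a Borel subgroup or in a Cartan subgroup,
or (ii) `G` is contained in the normaliser `N` of a Cartan subgroup `C` and not in `C`
("si `φ_l(G) ≠ Aut(E_l)`, on a, soit i), soit ii)"). [cite: Serre1972, §4.2 b)] -/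
theorem prop17_cases (G : Subgroup (GL (Fin 2) (ZMod p))) {C : Subgroup (GL (Fin 2) (ZMod p))}
    (hC : C ∈ cartanSubgroups (ZMod p)) (hCG : C ≤ G)
    (hp5 : (∃ P : GL (Fin 2) (ZMod p), C = splitCartan P) → p ≠ 5) :
    G = ⊤ ∨
      (∃ (v : Fin 2 → ZMod p) (hv : v ≠ 0), G ≤ eigenvectorStabilizer v hv) ∨
      (∃ C ∈ cartanSubgroups (ZMod p), G ≤ C) ∨
      ∃ C ∈ cartanSubgroups (ZMod p),
        G ≤ Subgroup.normalizer (C : Set (GL (Fin 2) (ZMod p))) ∧ ¬ G ≤ C := by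
  rcases prop17 G hC hCG hp5 with h | h | ⟨C', hC', hGN⟩
  · exact Or.inl h
  · exact Or.inr (Or.inl h)
  · by_cases hGC : G ≤ C'
    · exact Or.inr (Or.inr (Or.inl ⟨C', hC', hGC⟩))
    · exact Or.inr (Or.inr (Or.inr ⟨C', hC', hGN, hGC⟩))

/-- **§4.2 b), the list of cases, split half-Cartan hypothesis** (`p ≠ 5`; this is the form in
which §1 delivers the hypothesis at a place of ordinary or multiplicative reduction).
[cite: Serre1972, §4.2 b)] -/
theorem prop17_cases_halfSplitCartan (G : Subgroup (GL (Fin 2) (ZMod p))) (hp5 : p ≠ 5)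
    (P : GL (Fin 2) (ZMod p)) (hCG : halfSplitCartan P ≤ G) :
    G = ⊤ ∨
      (∃ (v : Fin 2 → ZMod p) (hv : v ≠ 0), G ≤ eigenvectorStabilizer v hv) ∨
      (∃ C ∈ cartanSubgroups (ZMod p), G ≤ C) ∨
      ∃ C ∈ cartanSubgroups (ZMod p),
        G ≤ Subgroup.normalizer (C : Set (GL (Fin 2) (ZMod p))) ∧ ¬ G ≤ C := by
  rcases prop17_halfSplitCartan G hp5 P hCG with h | h | ⟨C', hC', hGN⟩
  · exact Or.inl h
  · exact Or.inr (Or.inl h)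
  · by_cases hGC : G ≤ C'
    · exact Or.inr (Or.inr (Or.inl ⟨C', hC', hGC⟩))
    · exact Or.inr (Or.inr (Or.inr ⟨C', hC', hGN, hGC⟩))

/-- **A subgroup containing "complex conjugation" inside a Cartan subgroup is in a Borel
subgroup** (§5.4, proof of Prop. 21 i): "Le cas 2) est impossible, cf. n° 5.2"): if
`G ⊆ C`, `C` a Cartan subgroup of `GL₂(𝔽_p)`, `p ≠ 2`, and `G ∋ c` with `c² = 1`,
`det c = -1`, then `C` is split and `G` fixes a line.
[cite: Serre1972, §5.4, proof of Prop. 21 i)] -/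
theorem exists_le_eigenvectorStabilizer_of_le_cartan (hp2 : p ≠ 2)
    {G C : Subgroup (GL (Fin 2) (ZMod p))} (hC : C ∈ cartanSubgroups (ZMod p)) (hGC : G ≤ C)
    {c : GL (Fin 2) (ZMod p)} (hcG : c ∈ G) (hc : c * c = 1)
    (hdet : Matrix.det (c : Matrix (Fin 2) (Fin 2) (ZMod p)) = -1) :
    ∃ (v : Fin 2 → ZMod p) (hv : v ≠ 0), G ≤ eigenvectorStabilizer v hv := by
  rcases hC with ⟨P, rfl⟩ | ⟨k, hk, -, rfl⟩
  · exact ⟨_, col_ne_zero P 0, hGC.trans (splitCartan_le_eigenvectorStabilizer P)⟩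
  · exact absurd hGC
      (not_le_unitGroup_of_mem (DeligneSerre1974.two_ne_zero_of_ne_two hp2) hk hcG hc hdet)

/-- **Serre 1972, §5.4, proof of Prop. 21 i) (second paragraph), with §5.2 (iv) — split
half-Cartan hypothesis.**  Let `p ≠ 2, 5` and let `G ⊊ GL₂(𝔽_p)` contain a split half-Cartan
subgroup (§1: inertia at `p`, ordinary or multiplicative reduction, `p` unramified) and an element
`c` with `c² = 1`, `det c = -1` (§5.2 (iv): complex conjugation).  Then either 1) `G` is
contained in a Borel subgroup, or 3) `G` is contained in the normaliser of a Cartan subgroup `C`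
without being contained in `C` — case 2) "`G ⊆` non-split Cartan" being excluded by `c`, and
"`G ⊆` split Cartan" being a sub-case of 1).
[cite: Serre1972, §5.4, proof of Prop. 21 i); §5.2 (iv)] -/
theorem borel_or_normalizer_of_halfSplitCartan_le (G : Subgroup (GL (Fin 2) (ZMod p)))
    (hp2 : p ≠ 2) (hp5 : p ≠ 5) {P : GL (Fin 2) (ZMod p)} (hCG : halfSplitCartan P ≤ G)
    (hG : G ≠ ⊤) {c : GL (Fin 2) (ZMod p)} (hcG : c ∈ G) (hc : c * c = 1)
    (hdet : Matrix.det (c : Matrix (Fin 2) (Fin 2) (ZMod p)) = -1) :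
    (∃ (v : Fin 2 → ZMod p) (hv : v ≠ 0), G ≤ eigenvectorStabilizer v hv) ∨
      ∃ C ∈ cartanSubgroups (ZMod p),
        G ≤ Subgroup.normalizer (C : Set (GL (Fin 2) (ZMod p))) ∧ ¬ G ≤ C := by
  rcases prop17_cases_halfSplitCartan G hp5 P hCG with h | h | ⟨C, hC, hGC⟩ | h
  · exact absurd h hG
  · exact Or.inl h
  · exact Or.inl (exists_le_eigenvectorStabilizer_of_le_cartan hp2 hC hGC hcG hc hdet)
  · exact Or.inr h

/-- **Serre 1972, §5.4, proof of Prop. 21 i) (second paragraph), with §5.2 (iv) — non-split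
Cartan hypothesis** (§1.11 Prop. 12: inertia at a supersingular `p` is a non-split Cartan
subgroup).  Let `p ≠ 2` and let `G ⊊ GL₂(𝔽_p)` contain a non-split Cartan subgroup `kˣ` and an
element `c` with `c² = 1`, `det c = -1`.  Then `G` is contained in a Borel subgroup, or in the
normaliser of a Cartan subgroup `C` without being contained in `C`.
[cite: Serre1972, §5.4, proof of Prop. 21 i); §5.2 (iv)] -/
theorem borel_or_normalizer_of_unitGroup_le (G : Subgroup (GL (Fin 2) (ZMod p))) (hp2 : p ≠ 2)
    {k : Subalgebra (ZMod p) (Matrix (Fin 2) (Fin 2) (ZMod p))} (hk : IsField k)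
    (h2 : Module.finrank (ZMod p) k = 2) (hCG : unitGroup k ≤ G) (hG : G ≠ ⊤)
    {c : GL (Fin 2) (ZMod p)} (hcG : c ∈ G) (hc : c * c = 1)
    (hdet : Matrix.det (c : Matrix (Fin 2) (Fin 2) (ZMod p)) = -1) :
    (∃ (v : Fin 2 → ZMod p) (hv : v ≠ 0), G ≤ eigenvectorStabilizer v hv) ∨
      ∃ C ∈ cartanSubgroups (ZMod p),
        G ≤ Subgroup.normalizer (C : Set (GL (Fin 2) (ZMod p))) ∧ ¬ G ≤ C := by
  rcases prop17_unitGroup_of_ne_two G hp2 hk h2 hCG with h | h | ⟨C, hC, hGN⟩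
  · exact absurd h hG
  · exact Or.inl h
  · by_cases hGC : G ≤ C
    · exact Or.inl (exists_le_eigenvectorStabilizer_of_le_cartan hp2 hC hGC hcG hc hdet)
    · exact Or.inr ⟨C, hC, hGN, hGC⟩

/-- **Serre 1972, §5.4, proof of Prop. 21 i) (first paragraph).**  If `p ∣ |G|` (an element of
order `p`, "fourni par l'inertie en `p`" when `v_p(j) ≢ 0 mod l`) and `det G = 𝔽_pˣ` (§5.2
(iii)), then `G = GL₂(𝔽_p)` or `G` is contained in a Borel subgroup (Prop. 15).
[cite: Serre1972, §5.4, proof of Prop. 21 i); §2.4 Prop. 15] -/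
theorem eq_top_or_borel_of_dvd_card (G : Subgroup (GL (Fin 2) (ZMod p))) (hG : p ∣ Nat.card G)
    (hdet : ∀ u : (ZMod p)ˣ, ∃ g ∈ G, GeneralLinearGroup.det g = u) :
    G = ⊤ ∨ ∃ (v : Fin 2 → ZMod p) (hv : v ≠ 0), G ≤ eigenvectorStabilizer v hv := by
  rcases ker_det_le_or_exists_eigenvector_of_dvd_card G hG with h | ⟨v, hv, h⟩
  · exact Or.inl (eq_top_of_ker_det_le_of_det_surjective h hdet)
  · exact Or.inr ⟨v, hv, fun g hg ↦ mem_eigenvectorStabilizer_iff.mpr (h g hg)⟩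

end Prime

end Literature.NumberTheory.GaloisRepresentations.Serre1972
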